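import Mathlib
import HarnessLib
import Summits.AnomalousDissipation.AnomalousDissipation.Theses.DecimationAxis
import Literature.Analysis.FluidPDE.GalerkinFlow
import Literature.Analysis.FluidPDE.LongTimeAverageShift

/-!
# STUB-PLAN companion for `stub_tameRestart` (crux `DecimationAxis.UniformEquilibration`,
item stmt-AnomalousDissipation-1583, skeleton `Cruxes/UniformEquilibration/Lines/birth.lean`,
registered signature `Sig.stub_tameRestart`)

Stub critic's consolidated file = the merged plan EXECUTED: k3's architecture and proved
bookkeeping (case-free constants, `restart_margins`, dictionary / continuity / dissipation helpers —
copied from `STUB_IDEAS_stub_tameRestart_3.lean`, which is kernel-checked modulo ONE sorry, the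
unit-window enstrophy budget `enstrophy_window_budget`) with that single analytic step replaced by
the k1/k2 selection: **Lagrange's mean value theorem on the modal energy** (`exists_hasDerivAt_eq_slope`
+ the tree's `hasDerivWithinAt_energy`), which yields the tame instant directly — no FTC, no
integrability bookkeeping, no minimiser. Last theorem: `stub_tameRestart : Sig.stub_tameRestart` over a
VERBATIM copy of the skeleton's §0 vocabulary and `Sig` def (so the proof only uses their shape).
-/

set_option linter.dupNamespace false

noncomputable section

namespace Summit.AnomalousDissipation.AnomalousDissipation.Cruxes.UniformEquilibration.TameRestartPlan

open scoped BigOperators Topology Classical MeasureTheory InnerProductSpace ComplexConjugate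
open Filter Set Function MeasureTheory
open Literature.Analysis.FunctionSpaces Literature.Analysis.FunctionSpaces.Torus
open Literature.Analysis.FluidPDE
open Summit.AnomalousDissipation.AnomalousDissipation.Theses.DecimationAxis

/-- Integer frequencies (local notation). -/
local notation "ℤ³" => Fin 3 → ℤ
/-- Complex Fourier coefficient vectors (local notation). -/
local notation "ℂ³" => EuclideanSpace ℂ (Fin 3)

/-! ### §0 Vocabulary (verbatim from `Lines/birth.lean`) + modal enstrophy -/

/-- The crux's solution notion (verbatim copy of the skeleton's `IsCoeffTrajectory`). -/
def IsCoeffTrajectory (S : Finset ℤ³) (ν : ℝ) (g : ℤ³ → ℂ³) (c : ℝ → ↥S → ℂ³) : Prop :=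
  (∀ t, c t ∈ galerkinSubspace S) ∧ ContinuousOn c (Set.Ici 0) ∧
    ∀ T : ℝ, ∀ t ∈ Set.Icc (0 : ℝ) T,
      HasDerivWithinAt c (galerkinRHS S ν (fun k => g k) (c t)) (Set.Icc 0 T) t

/-- Modal energy (verbatim copy). -/
def modalEnergy {S : Finset ℤ³} (a : ↥S → ℂ³) : ℝ :=
  ∑ k : ↥S, ‖a k‖ ^ 2

/-- Resolved dissipation (verbatim copy). -/
def resolvedDissipation {S : Finset ℤ³} (ν : ℝ) (M : ℕ) (a : ↥S → ℂ³) : ℝ :=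
  ν * (4 * Real.pi ^ 2 * ∑ k : ↥S,
    if freqNormSq (k : ℤ³) ≤ (M : ℝ) ^ 2 then freqNormSq (k : ℤ³) * ‖a k‖ ^ 2 else 0)

/-- `H¹`-type size of a datum (verbatim copy). -/
def h1Size {S : Finset ℤ³} (a : ↥S → ℂ³) : ℝ :=
  ∑ k : ↥S, (1 + freqNormSq (k : ℤ³)) * ‖a k‖ ^ 2

/-- (helper vocabulary, k3) modal enstrophy `Σ_k |k|² ‖a_k‖²` (= `(eGradNormSq u).toReal / 4π²`). -/
def modalEnstrophy {S : Finset ℤ³} (a : ↥S → ℂ³) : ℝ :=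
  ∑ k : ↥S, freqNormSq (k : ℤ³) * ‖a k‖ ^ 2

/-- The registered stub signature (verbatim copy of the skeleton's `Sig.stub_tameRestart`). -/
def Sig.stub_tameRestart : Prop :=
  ∀ (ν : ℝ), 0 < ν → ∀ (N : ℕ) (g : ℤ³ → ℂ³), IsConjSymm g → (∀ k, k ∉ freqBall N → g k = 0) →
    g 0 = 0 → (∀ k : ℤ³, ∑ i, ((k i : ℤ) : ℂ) * g k i = 0) →
    ∀ (E ε : ℝ) (M : ℕ), 0 < ε → ∀ (T₁ E₁ ε₁ B₁ : ℝ), E₁ < 2 * E → ε < ε₁ →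
      ∃ (T₀ R : ℝ), ∀ (K : ℕ) (S : Finset ℤ³), S = (freqBall K).erase 0 →
        (∃ c : ℝ → ↥S → ℂ³, IsCoeffTrajectory S ν g c ∧ (∀ t, 0 ≤ t → modalEnergy (c t) ≤ B₁) ∧
            ∀ T : ℝ, T₁ ≤ T →
              timeMean (fun t => modalEnergy (c t)) T ≤ E₁ ∧
              ε₁ ≤ timeMean (fun t => resolvedDissipation ν M (c t)) T) →
        ∃ c : ℝ → ↥S → ℂ³, IsCoeffTrajectory S ν g c ∧ h1Size (c 0) ≤ R ∧
            ∀ T : ℝ, T₀ ≤ T →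
              timeMean (fun t => modalEnergy (c t)) T ≤ 2 * E ∧
              ε ≤ timeMean (fun t => resolvedDissipation ν M (c t)) T

/-! ### H0 — the truncation `(freqBall K).erase 0` is symmetric (k3, proved) -/

theorem neg_mem_of_eq_erase {K : ℕ} {S : Finset ℤ³} (hS : S = (freqBall K).erase 0) :
    ∀ k ∈ S, -k ∈ S := by
  intro k hk
  subst hS
  rw [Finset.mem_erase] at hk ⊢
  exact ⟨neg_ne_zero.2 hk.1, neg_mem_freqBall.2 hk.2⟩

/-! ### H1 — dictionary with `IsGalerkinODESolution`; autonomy (k1/k2/k3, proved) -/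

theorem isCoeffTrajectory_iff {S : Finset ℤ³} {ν : ℝ} {g : ℤ³ → ℂ³} {c : ℝ → ↥S → ℂ³} :
    IsCoeffTrajectory S ν g c ↔ IsGalerkinODESolution ν (fun k : ↥S => g k) (c 0) c :=
  ⟨fun h => ⟨rfl, h.1, h.2.1, h.2.2⟩, fun h => ⟨h.mem, h.continuousOn, h.hasDerivWithinAt⟩⟩

theorem IsCoeffTrajectory.comp_add {S : Finset ℤ³} {ν : ℝ} {g : ℤ³ → ℂ³} {c : ℝ → ↥S → ℂ³}
    (hc : IsCoeffTrajectory S ν g c) {s : ℝ} (hs : 0 ≤ s) :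
    IsCoeffTrajectory S ν g (fun τ => c (τ + s)) := by
  have h := (isCoeffTrajectory_iff.1 hc).comp_add hs
  exact ⟨h.mem, h.continuousOn, h.hasDerivWithinAt⟩

/-! ### H7 — continuity of the observables along a trajectory (k3, proved) -/

theorem continuousOn_modalEnergy {S : Finset ℤ³} {c : ℝ → ↥S → ℂ³} {A : Set ℝ}
    (hc : ContinuousOn c A) : ContinuousOn (fun t => modalEnergy (c t)) A := by
  unfold modalEnergy
  exact continuousOn_finsetSum _ fun k _ => ((continuous_apply k).comp_continuousOn hc).norm.pow 2

theorem continuousOn_resolvedDissipation {S : Finset ℤ³} (ν : ℝ) (M : ℕ) {c : ℝ → ↥S → ℂ³}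
    {A : Set ℝ} (hc : ContinuousOn c A) :
    ContinuousOn (fun t => resolvedDissipation ν M (c t)) A := by
  unfold resolvedDissipation
  refine continuousOn_const.mul (continuousOn_const.mul (continuousOn_finsetSum _ fun k _ => ?_))
  split_ifs
  · exact continuousOn_const.mul (((continuous_apply k).comp_continuousOn hc).norm.pow 2)
  · exact continuousOn_const

/-! ### H2 — THE TAME INSTANT BY LAGRANGE'S MVT (k1/k2 selection; the only analytic step) -/

/-- **Tame instant, `K`-uniformly.** Along a trajectory with `Σ‖c(t)_k‖² ≤ B` on `[0,1]` there is
`s ∈ (0,1)` with `ν·4π²·Σ|k|²‖c(s)_k‖² ≤ B + ½Σ_{k∈S}‖g k‖²`. Proof: the modal energy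
`ψ = Σ‖c_k‖²` is continuous on `[0,1]` and differentiable on `(0,1)` with
`ψ' = 2(−ν‖∇u‖² + ∫⟪G,u⟫)` (`hasDerivWithinAt_energy`); by `exists_hasDerivAt_eq_slope` some `s`
has `ψ'(s) = ψ(1) − ψ(0) ≥ −B`; at that instant `‖∇u‖² = 4π²·modalEnstrophy`
(`toReal_eGradNormSq_coeffExt`) and `2∫⟪G,u⟫ = 2Σ Re⟪g_k,c_k⟫ ≤ Σ‖g_k‖² + ψ(s) ≤ Σ‖g_k‖² + B`
(Parseval `integral_inner_realTrigPoly_realTrigPoly` + Young, the `hCS` block of `energy_deriv_le`). -/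
theorem exists_tame_instant {S : Finset ℤ³} (hS : ∀ k ∈ S, -k ∈ S) {ν : ℝ}
    {g : ℤ³ → ℂ³} (hg : IsConjSymm g) {c : ℝ → ↥S → ℂ³} (hc : IsCoeffTrajectory S ν g c)
    {B : ℝ} (hB : ∀ t ∈ Set.Icc (0 : ℝ) 1, modalEnergy (c t) ≤ B) :
    ∃ s ∈ Set.Ioo (0 : ℝ) 1,
      ν * (4 * Real.pi ^ 2 * modalEnstrophy (c s)) ≤ B + (∑ k : ↥S, ‖g k‖ ^ 2) / 2 := by
  have hgR : IsRealCoeff (S := S) fun k => g k := isRealCoeff_restrict hg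
  -- the energy identity in differential form, within `[0,1]`
  have hderiv : ∀ τ ∈ Icc (0 : ℝ) 1, HasDerivWithinAt (fun τ => ∑ k, ‖c τ k‖ ^ 2)
      (2 * (-(ν * (eGradNormSq (realTrigPoly S (coeffExt S (c τ)))).toReal) +
        ∫ x, ⟪realTrigPoly S (coeffExt S fun k : ↥S => g k) x,
          realTrigPoly S (coeffExt S (c τ)) x⟫_ℝ)) (Icc 0 1) τ := fun τ hτ =>
    hasDerivWithinAt_energy ν hS (hc.2.2 1 τ hτ) (hc.1 τ) hgR
  have hcont : ContinuousOn (fun τ => ∑ k, ‖c τ k‖ ^ 2) (Icc 0 1) := fun τ hτ =>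
    (hderiv τ hτ).continuousWithinAt
  -- Lagrange on `[0,1]`
  obtain ⟨s, hs, hslope⟩ := exists_hasDerivAt_eq_slope (fun τ => ∑ k, ‖c τ k‖ ^ 2)
    (fun τ => 2 * (-(ν * (eGradNormSq (realTrigPoly S (coeffExt S (c τ)))).toReal) +
        ∫ x, ⟪realTrigPoly S (coeffExt S fun k : ↥S => g k) x,
          realTrigPoly S (coeffExt S (c τ)) x⟫_ℝ)) zero_lt_one hcont
    (fun τ hτ => (hderiv τ (Ioo_subset_Icc_self hτ)).hasDerivAt (Icc_mem_nhds hτ.1 hτ.2))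
  refine ⟨s, hs, ?_⟩
  simp only [sub_zero, div_one] at hslope
  -- the two terms of `ψ' s` on the Fourier side
  have hmem : c s ∈ galerkinSubspace S := hc.1 s
  have hZ : (eGradNormSq (realTrigPoly S (coeffExt S (c s)))).toReal =
      4 * Real.pi ^ 2 * modalEnstrophy (c s) :=
    toReal_eGradNormSq_coeffExt hS hmem.1
  have hP : ∫ x, ⟪realTrigPoly S (coeffExt S fun k : ↥S => g k) x,
      realTrigPoly S (coeffExt S (c s)) x⟫_ℝ = ∑ k : ↥S, (inner ℂ (g k) (c s k)).re := by
    rw [integral_inner_realTrigPoly_realTrigPoly hS (hgR.isConjSymm_coeffExt hS)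
      (hmem.1.isConjSymm_coeffExt hS), ← Finset.sum_coe_sort]
    exact Finset.sum_congr rfl fun k _ => by rw [coeffExt_coe, coeffExt_coe]
  -- Young, termwise
  have hCS : ∑ k : ↥S, 2 * (inner ℂ (g k) (c s k)).re ≤ ∑ k : ↥S, (‖c s k‖ ^ 2 + ‖g k‖ ^ 2) :=
    Finset.sum_le_sum fun k _ => by
      have h1 : (inner ℂ (g k) (c s k)).re ≤ ‖g k‖ * ‖c s k‖ :=
        re_inner_le_norm (𝕜 := ℂ) (g k) (c s k)
      nlinarith [two_mul_le_add_sq ‖g k‖ ‖c s k‖]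
  rw [← Finset.mul_sum, Finset.sum_add_distrib] at hCS
  -- signs: `ψ 1 ≥ 0`, `ψ 0 ≤ B`, `ψ s ≤ B`
  have hψ1 : 0 ≤ ∑ k, ‖c 1 k‖ ^ 2 := Finset.sum_nonneg fun _ _ => sq_nonneg _
  have hψ0 : ∑ k, ‖c 0 k‖ ^ 2 ≤ B := hB 0 ⟨le_rfl, zero_le_one⟩
  have hψs : ∑ k, ‖c s k‖ ^ 2 ≤ B := hB s (Ioo_subset_Icc_self hs)
  rw [hZ, hP] at hslope
  linarith [hslope, hCS, hψ1, hψ0, hψs]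

/-- H2′ — the force budget is `K`-uniform: `Σ_{k∈S} ‖g k‖² ≤ Σ_{k∈freqBall N} ‖g k‖²` (k1/k3, proved). -/
theorem sum_norm_sq_restrict_le {N : ℕ} {g : ℤ³ → ℂ³} (hsupp : ∀ k, k ∉ freqBall N → g k = 0)
    (S : Finset ℤ³) : ∑ k : ↥S, ‖g k‖ ^ 2 ≤ ∑ k ∈ freqBall N, ‖g k‖ ^ 2 := by
  rw [Finset.sum_coe_sort S (fun k => ‖g k‖ ^ 2)]
  have hvan : ∀ x ∈ S \ (S ∩ freqBall N), ‖g x‖ ^ 2 = 0 := fun x hx => by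
    obtain ⟨hxS, hxn⟩ := Finset.mem_sdiff.1 hx
    rw [hsupp x fun hB => hxn (Finset.mem_inter.2 ⟨hxS, hB⟩)]
    simp
  rw [← Finset.sum_subset_zero_on_sdiff Finset.inter_subset_left hvan fun _ _ => rfl]
  exact Finset.sum_le_sum_of_subset_of_nonneg Finset.inter_subset_right fun _ _ _ => sq_nonneg _

/-! ### H4 — datum size = energy + enstrophy (k3, proved) -/

theorem h1Size_eq {S : Finset ℤ³} (a : ↥S → ℂ³) : h1Size a = modalEnergy a + modalEnstrophy a := by
  simp only [h1Size, modalEnergy, modalEnstrophy, add_mul, one_mul, Finset.sum_add_distrib]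

/-! ### H5 — pointwise tightness of the resolved dissipation (k1/k3, proved) -/

theorem resolvedDissipation_le {S : Finset ℤ³} {ν : ℝ} (hν : 0 ≤ ν) (M : ℕ) (a : ↥S → ℂ³) :
    resolvedDissipation ν M a ≤ ν * (4 * Real.pi ^ 2 * (M : ℝ) ^ 2) * modalEnergy a := by
  have hsum : (∑ k : ↥S, if freqNormSq (k : ℤ³) ≤ (M : ℝ) ^ 2 then
      freqNormSq (k : ℤ³) * ‖a k‖ ^ 2 else 0) ≤ (M : ℝ) ^ 2 * modalEnergy a := by
    unfold modalEnergy
    rw [Finset.mul_sum]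
    refine Finset.sum_le_sum fun k _ => ?_
    split_ifs with h
    · exact mul_le_mul_of_nonneg_right h (sq_nonneg _)
    · positivity
  have h4 : (0 : ℝ) ≤ 4 * Real.pi ^ 2 := by positivity
  have h := mul_le_mul_of_nonneg_left (mul_le_mul_of_nonneg_left hsum h4) hν
  unfold resolvedDissipation
  calc _ ≤ ν * (4 * Real.pi ^ 2 * ((M : ℝ) ^ 2 * modalEnergy a)) := h
    _ = _ := by ring

theorem resolvedDissipation_nonneg {S : Finset ℤ³} {ν : ℝ} (hν : 0 ≤ ν) (M : ℕ) (a : ↥S → ℂ³) :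
    0 ≤ resolvedDissipation ν M a := by
  unfold resolvedDissipation
  refine mul_nonneg hν (mul_nonneg (by positivity) (Finset.sum_nonneg fun k _ => ?_))
  split_ifs
  · exact mul_nonneg (freqNormSq_nonneg _) (sq_nonneg _)
  · exact le_rfl

theorem modalEnergy_nonneg {S : Finset ℤ³} (a : ↥S → ℂ³) : 0 ≤ modalEnergy a :=
  Finset.sum_nonneg fun _ _ => sq_nonneg _

/-! ### H6 — running means of a restart (the quantified neighbour of
`longTimeAvgSup_comp_add_right`; both are one `timeMean_comp_add_right` away) -/

/-- Upper: `timeMean (φ(·+s)) T ≤ ((T+s)/T) · timeMean φ (T+s)` for `φ ≥ 0`. -/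
theorem timeMean_comp_add_right_le {φ : ℝ → ℝ} (hφ : ∀ t, 0 ≤ φ t)
    (hint : ∀ a b, 0 ≤ a → a ≤ b → IntervalIntegrable φ volume a b) {s : ℝ} (hs : 0 ≤ s)
    {T : ℝ} (hT : 0 < T) :
    timeMean (fun t => φ (t + s)) T ≤ (T + s) / T * timeMean φ (T + s) := by
  rw [timeMean_comp_add_right hs hT (hint 0 s le_rfl hs) (hint s (T + s) hs (by linarith))]
  have hI : 0 ≤ ∫ t in (0 : ℝ)..s, φ t := intervalIntegral.integral_nonneg hs fun t _ => hφ t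
  have : 0 ≤ T⁻¹ * ∫ t in (0 : ℝ)..s, φ t := mul_nonneg (inv_nonneg.2 hT.le) hI
  linarith

/-- Lower: `timeMean φ (T+s) − s·D/T ≤ timeMean (φ(·+s)) T` for `0 ≤ φ ≤ D` on `[0,s]`. -/
theorem le_timeMean_comp_add_right {φ : ℝ → ℝ} (hφ : ∀ t, 0 ≤ φ t)
    (hint : ∀ a b, 0 ≤ a → a ≤ b → IntervalIntegrable φ volume a b) {s D : ℝ} (hs : 0 ≤ s)
    (hD : ∀ t ∈ Set.Icc 0 s, φ t ≤ D) {T : ℝ} (hT : 0 < T) :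
    timeMean φ (T + s) - s * D / T ≤ timeMean (fun t => φ (t + s)) T := by
  rw [timeMean_comp_add_right hs hT (hint 0 s le_rfl hs) (hint s (T + s) hs (by linarith))]
  have hI : ∫ t in (0 : ℝ)..s, φ t ≤ s * D := by
    have h := intervalIntegral.integral_mono_on hs (hint 0 s le_rfl hs) intervalIntegrable_const
      (fun t ht => hD t ht)
    simpa using h
  have hTs : 0 < T + s := by linarith
  have hmean : 0 ≤ timeMean φ (T + s) := by
    unfold timeMean
    exact mul_nonneg (inv_nonneg.2 hTs.le)
      (intervalIntegral.integral_nonneg hTs.le fun t _ => hφ t)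
  have h1 : timeMean φ (T + s) ≤ (T + s) / T * timeMean φ (T + s) := by
    have : 1 ≤ (T + s) / T := by rw [le_div_iff₀ hT]; linarith
    nlinarith
  have h2 : T⁻¹ * ∫ t in (0 : ℝ)..s, φ t ≤ s * D / T := by
    rw [div_eq_inv_mul]
    exact mul_le_mul_of_nonneg_left hI (inv_nonneg.2 hT.le)
  linarith

/-! ### H6⁺ — the whole ε/δ arithmetic as ONE real-variable lemma (k3; consumed by the assembly) -/

/-- The margins pay for the restart: with `T₀ := max T₁ 1 + |E₁|/(2E − E₁) + D/(ε₁ − ε)`. -/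
theorem restart_margins {φ ψ : ℝ → ℝ} (hφ : ∀ t, 0 ≤ φ t) (hψ : ∀ t, 0 ≤ ψ t)
    (hφi : ∀ a b, 0 ≤ a → a ≤ b → IntervalIntegrable φ volume a b)
    (hψi : ∀ a b, 0 ≤ a → a ≤ b → IntervalIntegrable ψ volume a b)
    {E E₁ ε ε₁ T₁ D s : ℝ} (hE : E₁ < 2 * E) (hε : ε < ε₁) (hD0 : 0 ≤ D)
    (hs : s ∈ Set.Icc (0 : ℝ) 1) (hDψ : ∀ t ∈ Set.Icc 0 s, ψ t ≤ D)
    (hset : ∀ T, T₁ ≤ T → timeMean φ T ≤ E₁ ∧ ε₁ ≤ timeMean ψ T) {T : ℝ}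
    (hT : max T₁ 1 + |E₁| / (2 * E - E₁) + D / (ε₁ - ε) ≤ T) :
    timeMean (fun t => φ (t + s)) T ≤ 2 * E ∧ ε ≤ timeMean (fun t => ψ (t + s)) T := by
  have hgap : 0 < 2 * E - E₁ := by linarith
  have hgap' : 0 < ε₁ - ε := by linarith
  have hA : 0 ≤ |E₁| / (2 * E - E₁) := div_nonneg (abs_nonneg _) hgap.le
  have hB : 0 ≤ D / (ε₁ - ε) := div_nonneg hD0 hgap'.le
  have hT1 : 1 ≤ T := by linarith [le_max_right T₁ 1]
  have hT0 : 0 < T := by linarith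
  have hTT₁ : T₁ ≤ T + s := by linarith [le_max_left T₁ 1, hs.1]
  obtain ⟨hEm, hεm⟩ := hset (T + s) hTT₁
  constructor
  · -- energy side
    have h1 := timeMean_comp_add_right_le hφ hφi hs.1 hT0
    have hratio : 0 ≤ (T + s) / T := div_nonneg (by linarith [hs.1]) hT0.le
    have h2 : (T + s) / T * timeMean φ (T + s) ≤ (T + s) / T * E₁ :=
      mul_le_mul_of_nonneg_left hEm hratio
    -- `(T+s)/T * E₁ = E₁ + (s/T) E₁ ≤ E₁ + |E₁|/T ≤ 2E`
    have h3 : (T + s) / T * E₁ ≤ E₁ + |E₁| / T := by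
      have hsT : (T + s) / T * E₁ = E₁ + s / T * E₁ := by
        field_simp
      rw [hsT]
      have : s / T * E₁ ≤ |E₁| / T := by
        rw [div_mul_eq_mul_div, div_le_div_iff_of_pos_right hT0]
        calc s * E₁ ≤ s * |E₁| := mul_le_mul_of_nonneg_left (le_abs_self _) hs.1
          _ ≤ 1 * |E₁| := mul_le_mul_of_nonneg_right hs.2 (abs_nonneg _)
          _ = |E₁| := one_mul _
      linarith
    have h4 : |E₁| / T ≤ 2 * E - E₁ := by
      rw [div_le_iff₀ hT0]
      have hT' : |E₁| / (2 * E - E₁) ≤ T := by linarith [le_max_right T₁ 1]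
      have := (div_le_iff₀ hgap).1 hT'
      linarith [this]
    linarith
  · -- dissipation side
    have h1 := le_timeMean_comp_add_right hψ hψi hs.1 hDψ hT0
    have h2 : s * D / T ≤ D / T := by
      apply div_le_div_of_nonneg_right _ hT0.le
      nlinarith [hs.1, hs.2]
    have h3 : D / T ≤ ε₁ - ε := by
      rw [div_le_iff₀ hT0]
      have hT' : D / (ε₁ - ε) ≤ T := by linarith [le_max_right T₁ 1]
      have := (div_le_iff₀ hgap').1 hT'
      linarith [this]
    linarith

/-! ### Assembly — the registered stub, by the helpers -/

/-- **`stub_tameRestart` (registered signature, verbatim).** Case-free `K`-uniform witnesses: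
`G2 := Σ_{k∈freqBall N}‖g k‖²`, `D := ν·4π²M²·|B₁|`, `T₀ := max T₁ 1 + |E₁|/(2E−E₁) + D/(ε₁−ε)`,
`R := B₁ + (B₁ + G2/2)/(ν·4π²)`. Shape: SELECT a tame instant `s ∈ (0,1)` by the MVT budget (H2 + H2′),
SHIFT the trajectory to it (H1; datum bound by H4), and let the margins pay for the lost prefix
(`restart_margins`, fed by H5/H7). Unused binders (`g 0 = 0`, transversality, `0 < ε`) are ignored. -/
theorem stub_tameRestart : Sig.stub_tameRestart := by
  intro ν hν N g hcs hsupp _h0 _hdiv E ε M _hε T₁ E₁ ε₁ B₁ hE hεε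
  set G2 : ℝ := ∑ k ∈ freqBall N, ‖g k‖ ^ 2 with hG2
  set D : ℝ := ν * (4 * Real.pi ^ 2 * (M : ℝ) ^ 2) * |B₁| with hD
  refine ⟨max T₁ 1 + |E₁| / (2 * E - E₁) + D / (ε₁ - ε),
    B₁ + (B₁ + G2 / 2) / (ν * (4 * Real.pi ^ 2)), ?_⟩
  rintro K S hS ⟨c, hc, hball, hset⟩
  have hS' : ∀ k ∈ S, -k ∈ S := neg_mem_of_eq_erase hS
  have hν4 : 0 < ν * (4 * Real.pi ^ 2) := by positivity
  -- (1) SELECT: a tame instant in `(0,1)`, with a `K`-uniform enstrophy bound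
  obtain ⟨s, hs, hZν⟩ := exists_tame_instant hS' hcs hc (B := B₁) (fun t ht => hball t ht.1)
  have hG : ∑ k : ↥S, ‖g k‖ ^ 2 ≤ G2 := sum_norm_sq_restrict_le hsupp S
  have hZs : modalEnstrophy (c s) ≤ (B₁ + G2 / 2) / (ν * (4 * Real.pi ^ 2)) := by
    rw [le_div_iff₀ hν4]
    nlinarith [hZν, hG]
  have hs' : s ∈ Set.Icc (0 : ℝ) 1 := Set.Ioo_subset_Icc_self hs
  -- (2) SHIFT: restart there; the margins pay for the lost prefix
  refine ⟨fun τ => c (τ + s), hc.comp_add hs'.1, ?_, ?_⟩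
  · show h1Size (c (0 + s)) ≤ _
    rw [zero_add, h1Size_eq]
    exact add_le_add (hball s hs'.1) hZs
  · intro T hT
    have hB₁ : 0 ≤ B₁ := (modalEnergy_nonneg _).trans (hball 0 le_rfl)
    have hcont : ContinuousOn c (Set.Ici 0) := hc.2.1
    have hsub : ∀ a b : ℝ, 0 ≤ a → a ≤ b → Set.uIcc a b ⊆ Set.Ici 0 := fun a b ha hab => by
      rw [Set.uIcc_of_le hab]
      exact fun t ht => ha.trans ht.1
    have hφi : ∀ a b, 0 ≤ a → a ≤ b →
        IntervalIntegrable (fun t => modalEnergy (c t)) volume a b := fun a b ha hab =>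
      ((continuousOn_modalEnergy hcont).mono (hsub a b ha hab)).intervalIntegrable
    have hψi : ∀ a b, 0 ≤ a → a ≤ b →
        IntervalIntegrable (fun t => resolvedDissipation ν M (c t)) volume a b := fun a b ha hab =>
      ((continuousOn_resolvedDissipation ν M hcont).mono (hsub a b ha hab)).intervalIntegrable
    have hD0 : 0 ≤ D := by rw [hD]; positivity
    have hDψ : ∀ t ∈ Set.Icc 0 s, resolvedDissipation ν M (c t) ≤ D := by
      intro t ht
      refine (resolvedDissipation_le hν.le M (c t)).trans ?_
      rw [hD, abs_of_nonneg hB₁]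
      exact mul_le_mul_of_nonneg_left (hball t ht.1) (by positivity)
    exact restart_margins (fun t => modalEnergy_nonneg _)
      (fun t => resolvedDissipation_nonneg hν.le M _) hφi hψi hE hεε hD0 hs' hDψ hset hT

end Summit.AnomalousDissipation.AnomalousDissipation.Cruxes.UniformEquilibration.TameRestartPlan

end
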